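import Literature.AlgebraicGeometry.Morphisms.CechModuleRefinement
import Literature.AlgebraicGeometry.Modules.AffineLocalizing
import Literature.AlgebraicGeometry.Modules.LocalFrames
import Mathlib.AlgebraicGeometry.Morphisms.ClosedImmersion

/-!
# Affine-localizing modules: locality, `𝓗om(V, M)` for `V` finite locally free, direct images (EB1)

Support lemmas for stub EB1 (`stub_towerPresentation`) of line `chow-zariski-pushforward` of the crux
`FormalVectorBundlesAlgebraize` (route `PadicSemiregularLift` of `HodgeConjecture`). The Čech machinery
of the tree (`Morphisms/CechModuleShortExact`, `CechModuleExact`) consumes the affine-local property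
`IsAffineLocalizing` (numerators and torsion on the principal opens of EVERY affine open, Hartshorne II
Lemma 5.3); we supply three producers:

* `isAffineLocalizing_of_local` — **the property is local**: it suffices to check numerators and torsion
  on the affine opens inside the members of an open cover (Hartshorne II Prop. 5.4: cover an affine `V`
  by finitely many small principal opens, extend on each, glue after killing the differences by a power
  of `r`);
* `isAffineLocalizing_sheafHom` — `𝓗om(V, M)` is affine-localizing for `V` finite locally free and `M`
  affine-localizing (on a trivialising affine, a morphism `V|_W → M|_W` is the tuple of the images of
  the basis sections, tree `homOfBasisValues`, `hom_ext_of_basisSection`);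
* `isAffineLocalizing_pushforward` — `i_* F` is affine-localizing for `F` affine-localizing and `i`
  a closed immersion (`i⁻¹` of an affine is affine, `i⁻¹ D(r) = D(i♯ r)`).

Everything is proved; no definitions.
-/

noncomputable section

-- Summit.HodgeConjecture.HodgeConjecture.… repeats the summit name by the D-0017 layout (Sub = Summit).
set_option linter.dupNamespace false
-- `TopCat.Presheaf`/`TopCat.Sheaf` are not reducible (as in Mathlib's `AlgebraicGeometry/Modules`).
set_option backward.isDefEq.respectTransparency false

open CategoryTheory CategoryTheory.Limits AlgebraicGeometry TopologicalSpace Opposite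
open Literature.AlgebraicGeometry.Motives Literature.AlgebraicGeometry.Modules
open Literature.AlgebraicGeometry.Morphisms

universe u

namespace Summit.HodgeConjecture.HodgeConjecture.Theorems.FormalVectorBundlesAlgebraize

variable {X : Scheme.{u}}

/-! ### Finite principal covers of an affine open subordinate to a family of neighbourhoods -/

/-- An affine open `V₀` is covered by finitely many of its principal opens `D(g_y)`, `y ∈ V₀`, with
`y ∈ D(g_y) ⊆ U_y` for prescribed neighbourhoods `U_y ∋ y`. -/
theorem exists_finite_basicOpen_cover {V₀ : X.Opens} (hV₀ : IsAffineOpen V₀) (U : X → X.Opens)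
    (hU : ∀ x, x ∈ U x) :
    ∃ (g : V₀ → Γ(X, V₀)) (t : Finset V₀), (∀ y, X.basicOpen (g y) ≤ U y) ∧
      V₀ ≤ ⨆ y : t, X.basicOpen (g y.1) := by
  choose g hgU hyg using fun y : V₀ => hV₀.exists_basicOpen_le ⟨(y : X), hU y⟩ y.2
  obtain ⟨t, ht⟩ := hV₀.isCompact.elim_finite_subcover (fun y : V₀ => (X.basicOpen (g y) : Set X))
    (fun y => (X.basicOpen (g y)).isOpen) fun z hz => Set.mem_iUnion.mpr ⟨⟨z, hz⟩, hyg ⟨z, hz⟩⟩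
  refine ⟨g, t, hgU, fun z hz => ?_⟩
  obtain ⟨y, hy⟩ := Set.mem_iUnion.mp (ht hz)
  obtain ⟨hyt, hzy⟩ := Set.mem_iUnion.mp hy
  exact Opens.mem_iSup.mpr ⟨⟨y, hyt⟩, hzy⟩

/-! ### Locality of `IsAffineLocalizing` -/

section Local

variable (M : X.Modules)

/-- The basic open of a restricted function: `D(r|_W) = W ∩ D(r)`. -/
theorem basicOpen_sectionsRes {A : Type u} [CommRing A] (f : X ⟶ Spec (.of A)) {V W : X.Opens}
    (h : W ≤ V) (r : Sections f V) : X.basicOpen (Sections.res f h r) = W ⊓ X.basicOpen r :=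
  Scheme.basicOpen_res _ _ _

/-- **`IsAffineLocalizing` is a local property** (Hartshorne II Prop. 5.4 in the language of II Lemma
5.3): if every point has a neighbourhood `U` such that the numerator and torsion properties hold on
every affine open `V ≤ U`, then they hold on every affine open. -/
theorem isAffineLocalizing_of_local
    (h : ∀ x : X, ∃ U : X.Opens, x ∈ U ∧
      (∀ ⦃V : X.Opens⦄ (_ : IsAffineOpen V), V ≤ U → ∀ (r : Γ(X, V)) {W : X.Opens}
        (hW : W = X.basicOpen r) (s : Γ(M, W)), ∃ (n : ℕ) (x : Γ(M, V)),
          M.presheaf.map (homOfLE (hW.trans_le (X.basicOpen_le r))).op x =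
            X.presheaf.map (homOfLE (hW.trans_le (X.basicOpen_le r))).op r ^ n • s) ∧
      (∀ ⦃V : X.Opens⦄ (_ : IsAffineOpen V), V ≤ U → ∀ (r : Γ(X, V)) (x : Γ(M, V)) {W : X.Opens}
        (hWV : W ≤ V), X.basicOpen r ≤ W → M.presheaf.map (homOfLE hWV).op x = 0 →
          ∃ n : ℕ, r ^ n • x = 0)) :
    IsAffineLocalizing M := by
  classical
  choose U hxU hnum htor using h
  obtain ⟨f₀⟩ : Nonempty (X ⟶ Spec Γ(X, ⊤)) := ⟨X.toSpecΓ⟩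
  constructor
  · -- numerators
    intro V₀ hV₀ r W hW s
    subst hW
    obtain ⟨g, t, hgU, hcov⟩ := exists_finite_basicOpen_cover hV₀ U hxU
    -- the pieces `V_y = D(g_y)` (affine, inside `U_y` and `V₀`), `W_y = V_y ∩ D(r)`, `V_yz = V_y ∩ V_z`
    have hVaff : ∀ y : t, IsAffineOpen (X.basicOpen (g y.1)) := fun y => hV₀.basicOpen _
    have hVle : ∀ y : t, X.basicOpen (g y.1) ≤ V₀ := fun y => X.basicOpen_le _
    have hWV : ∀ y : t, X.basicOpen (g y.1) ⊓ X.basicOpen r ≤ X.basicOpen (g y.1) := fun y => inf_le_left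
    have hWD : ∀ y : t, X.basicOpen (g y.1) ⊓ X.basicOpen r ≤ X.basicOpen r := fun y => inf_le_right
    have hYl : ∀ y z : t, X.basicOpen (g y.1) ⊓ X.basicOpen (g z.1) ≤ X.basicOpen (g y.1) :=
      fun y z => inf_le_left
    have hYr : ∀ y z : t, X.basicOpen (g y.1) ⊓ X.basicOpen (g z.1) ≤ X.basicOpen (g z.1) :=
      fun y z => inf_le_right
    have hTl : ∀ y z : t, (X.basicOpen (g y.1) ⊓ X.basicOpen (g z.1)) ⊓ X.basicOpen r ≤
        X.basicOpen (g y.1) ⊓ X.basicOpen (g z.1) := fun y z => inf_le_left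
    have hTy : ∀ y z : t, (X.basicOpen (g y.1) ⊓ X.basicOpen (g z.1)) ⊓ X.basicOpen r ≤
        X.basicOpen (g y.1) ⊓ X.basicOpen r := fun y z => inf_le_inf_right _ (hYl y z)
    have hTz : ∀ y z : t, (X.basicOpen (g y.1) ⊓ X.basicOpen (g z.1)) ⊓ X.basicOpen r ≤
        X.basicOpen (g z.1) ⊓ X.basicOpen r := fun y z => inf_le_inf_right _ (hYr y z)
    have hWy : ∀ y : t, X.basicOpen (g y.1) ⊓ X.basicOpen r =
        X.basicOpen (Sections.res f₀ (hVle y) r) := fun y => (basicOpen_sectionsRes f₀ (hVle y) r).symm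
    -- local numerators, exponents made uniform
    choose n x hx using fun y : t => hnum y.1.1 (hVaff y) (hgU y.1) (Sections.res f₀ (hVle y) r) (hWy y)
      (MSections.res f₀ M (hWD y) s)
    have hx1 : ∀ y : t, MSections.res f₀ M (hWV y) (x y) =
        Sections.res f₀ ((hWV y).trans (hVle y)) r ^ n y • MSections.res f₀ M (hWD y) s := by
      intro y
      rw [← Sections.res_res f₀ (hVle y) (hWV y) r]
      exact hx y
    obtain ⟨N, hN⟩ : ∃ N : ℕ, ∀ y, n y ≤ N := ⟨Finset.univ.sup n, fun y => Finset.le_sup (Finset.mem_univ y)⟩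
    obtain ⟨x', hx'⟩ : ∃ x' : ∀ y : t, MSections f₀ M (X.basicOpen (g y.1)),
        ∀ y : t, MSections.res f₀ M (hWV y) (x' y) =
          Sections.res f₀ ((hWV y).trans (hVle y)) r ^ N • MSections.res f₀ M (hWD y) s := by
      refine ⟨fun y => Sections.res f₀ (hVle y) r ^ (N - n y) •
        (show MSections f₀ M (X.basicOpen (g y.1)) from x y), fun y => ?_⟩
      change MSections.res f₀ M (hWV y) (Sections.res f₀ (hVle y) r ^ (N - n y) •
        (show MSections f₀ M (X.basicOpen (g y.1)) from x y)) = _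
      rw [MSections.res_smul, map_pow, Sections.res_res, hx1, ← mul_smul, ← pow_add,
        Nat.sub_add_cancel (hN y)]
    -- the differences on the overlaps vanish on `D(r)`, hence are killed by a uniform power of `r`
    have hdiff : ∀ y z : t, ∃ m : ℕ, Sections.res f₀ ((hYl y z).trans (hVle y)) r ^ m •
        (MSections.res f₀ M (hYl y z) (x' y) - MSections.res f₀ M (hYr y z) (x' z)) = 0 := by
      intro y z
      have hVyz : IsAffineOpen (X.basicOpen (g y.1) ⊓ X.basicOpen (g z.1)) := by
        rw [← Scheme.basicOpen_mul]; exact hV₀.basicOpen _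
      refine htor y.1.1 hVyz ((hYl y z).trans (hgU y.1)) _ _ (hTl y z)
        (basicOpen_sectionsRes f₀ _ r).le ?_
      change MSections.res f₀ M (hTl y z) _ = 0
      rw [map_sub, MSections.res_res, MSections.res_res, sub_eq_zero,
        ← MSections.res_res f₀ M (hWV y) (hTy y z) (x' y), ← MSections.res_res f₀ M (hWV z) (hTz y z) (x' z),
        hx' y, hx' z, MSections.res_smul, MSections.res_smul, map_pow, map_pow, Sections.res_res,
        Sections.res_res, MSections.res_res, MSections.res_res]
    choose m hm using hdiff
    obtain ⟨N', hN'⟩ : ∃ N' : ℕ, ∀ y z, m y z ≤ N' :=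
      ⟨Finset.univ.sup fun q : t × t => m q.1 q.2, fun y z =>
        Finset.le_sup (f := fun q : t × t => m q.1 q.2) (Finset.mem_univ (y, z))⟩
    let x'' : ∀ y : t, MSections f₀ M (X.basicOpen (g y.1)) := fun y =>
      Sections.res f₀ (hVle y) r ^ N' • x' y
    -- glue the corrected local extensions
    obtain ⟨T, hT⟩ := MSections.exists_res_eq f₀ M (fun y : t => X.basicOpen (g y.1)) hVle hcov x'' (by
      intro y z
      change MSections.res f₀ M (hYl y z) (Sections.res f₀ (hVle y) r ^ N' • x' y) =
        MSections.res f₀ M (hYr y z) (Sections.res f₀ (hVle z) r ^ N' • x' z)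
      rw [MSections.res_smul, MSections.res_smul, map_pow, map_pow, Sections.res_res, Sections.res_res,
        ← sub_eq_zero, Sections.res_eq_res f₀ _ ((hYl y z).trans (hVle y)) r, ← smul_sub,
        ← Nat.sub_add_cancel (hN' y z), pow_add, mul_smul]
      change _ • (Sections.res f₀ _ r ^ m y z • _) = (0 : MSections f₀ M _)
      rw [hm y z, smul_zero])
    refine ⟨N' + N, T, ?_⟩
    -- `T|_{D(r)} = r^{N'+N} s`, checked on the cover `(V_y ∩ D(r))_y` of `D(r)`
    have hcovD : X.basicOpen r ≤ ⨆ y : t, X.basicOpen (g y.1) ⊓ X.basicOpen r := by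
      rw [← iSup_inf_eq]
      exact le_inf ((X.basicOpen_le r).trans hcov) le_rfl
    change MSections.res f₀ M (X.basicOpen_le r) T =
      Sections.res f₀ (X.basicOpen_le r) r ^ (N' + N) • (show MSections f₀ M (X.basicOpen r) from s)
    apply MSections.eq_of_res_eq f₀ M (fun y : t => X.basicOpen (g y.1) ⊓ X.basicOpen r) hWD hcovD
    intro y
    rw [MSections.res_res, ← MSections.res_res f₀ M (hVle y) (hWV y) T, hT y]
    change MSections.res f₀ M (hWV y) (Sections.res f₀ (hVle y) r ^ N' • x' y) = _
    rw [MSections.res_smul, map_pow, Sections.res_res, hx' y, MSections.res_smul, map_pow,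
      Sections.res_res, ← mul_smul, ← pow_add]
  · -- torsion
    intro V₀ hV₀ r x W hWV hrW hx
    obtain ⟨g, t, hgU, hcov⟩ := exists_finite_basicOpen_cover hV₀ U hxU
    have hVaff : ∀ y : t, IsAffineOpen (X.basicOpen (g y.1)) := fun y => hV₀.basicOpen _
    have hVle : ∀ y : t, X.basicOpen (g y.1) ≤ V₀ := fun y => X.basicOpen_le _
    have hIl : ∀ y : t, X.basicOpen (g y.1) ⊓ W ≤ X.basicOpen (g y.1) := fun y => inf_le_left
    have hIr : ∀ y : t, X.basicOpen (g y.1) ⊓ W ≤ W := fun y => inf_le_right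
    choose n hn using fun y : t => htor y.1.1 (hVaff y) (hgU y.1) (Sections.res f₀ (hVle y) r)
      (MSections.res f₀ M (hVle y) x) (hIl y)
      (by rw [basicOpen_sectionsRes]; exact inf_le_inf_left _ hrW)
      (by
        change MSections.res f₀ M (hIl y) (MSections.res f₀ M (hVle y) x) = 0
        rw [MSections.res_res, ← MSections.res_res f₀ M hWV (hIr y) x]
        change MSections.res f₀ M (hIr y) (M.presheaf.map (homOfLE hWV).op x) = 0
        rw [hx, map_zero])
    obtain ⟨N, hN⟩ : ∃ N : ℕ, ∀ y, n y ≤ N := ⟨Finset.univ.sup n, fun y => Finset.le_sup (Finset.mem_univ y)⟩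
    refine ⟨N, ?_⟩
    apply MSections.eq_of_res_eq f₀ M (fun y : t => X.basicOpen (g y.1)) hVle hcov
    intro y
    change MSections.res f₀ M _ ((show Sections f₀ V₀ from r) ^ N • (show MSections f₀ M V₀ from x)) =
      MSections.res f₀ M _ 0
    rw [map_zero, MSections.res_smul, map_pow, ← Nat.sub_add_cancel (hN y), pow_add, mul_smul, hn,
      smul_zero]

end Local

/-! ### `𝓗om(V, M)` is affine-localizing for `V` finite locally free -/

section SheafHom

variable {V M : X.Modules} (hM : IsAffineLocalizing M) {U : X.Opens} {I : Type u} [Fintype I]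

include hM in
/-- Numerators for `𝓗om(V, M)` on an affine open `V'` inside a trivialising open `U` of `V`:
extend the images of the basis sections. -/
theorem sheafHom_numerator (e : SheafOfModules.free I ≅ V.over U) {V' : X.Opens} (hV' : IsAffineOpen V')
    (hV'U : V' ≤ U) (r : Γ(X, V')) {W : X.Opens} (hW : W = X.basicOpen r) (s : Γ(sheafHom V M, W)) :
    ∃ (n : ℕ) (x : Γ(sheafHom V M, V')),
      (sheafHom V M).presheaf.map (homOfLE (hW.trans_le (X.basicOpen_le r))).op x =
        X.presheaf.map (homOfLE (hW.trans_le (X.basicOpen_le r))).op r ^ n • s := by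
  classical
  subst hW
  let k : X.basicOpen r ⟶ V' := homOfLE (X.basicOpen_le r)
  let eV : SheafOfModules.free I ≅ V.over V' :=
    SheafOfModules.restrictTrivialisation (R := X.ringCatSheaf) (homOfLE hV'U) e
  let eW : SheafOfModules.free I ≅ V.over (X.basicOpen r) :=
    SheafOfModules.restrictTrivialisation (R := X.ringCatSheaf) k eV
  let φ : V.over (X.basicOpen r) ⟶ M.over (X.basicOpen r) := s
  -- extend the images of the basis sections, with a uniform exponent
  choose n y hy using fun i : I => hM.numerator hV' r rfl (appLE φ (𝟙 _) (basisSection eW i))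
  obtain ⟨N, hN⟩ : ∃ N : ℕ, ∀ i, n i ≤ N := ⟨Finset.univ.sup n, fun i => Finset.le_sup (Finset.mem_univ i)⟩
  let y' : I → Γ(M, V') := fun i => r ^ (N - n i) • y i
  have hy' : ∀ i, M.presheaf.map k.op (y' i) =
      X.presheaf.map k.op r ^ N • appLE φ (𝟙 _) (basisSection eW i) := by
    intro i
    simp only [y', Scheme.Modules.map_smul, map_pow]
    rw [hy i, ← mul_smul, ← pow_add, Nat.sub_add_cancel (hN i)]
  refine ⟨N, (homOfBasisValues eV y' : Γ(sheafHom V M, V')), ?_⟩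
  change restrictHom k (homOfBasisValues eV y') = X.presheaf.map k.op r ^ N • φ
  refine hom_ext_of_basisSection eW fun i => ?_
  rw [appLE_restrictHom, appLE_smul, structurePresheaf_map_id, ← hy' i,
    appLE_congr_hom _ (𝟙 _ ≫ k) (k ≫ 𝟙 V'),
    show basisSection eW i = V.presheaf.map k.op (basisSection eV i) from
      basisSection_restrictTrivialisation k eV i,
    appLE_map, appLE_homOfBasisValues]

include hM in
/-- Torsion for `𝓗om(V, M)` on an affine open `V'` inside a trivialising open `U` of `V`: a morphism
vanishing near `D(r)` has its values on the basis sections killed by a power of `r`. -/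
theorem sheafHom_torsion (e : SheafOfModules.free I ≅ V.over U) {V' : X.Opens} (hV' : IsAffineOpen V')
    (hV'U : V' ≤ U) (r : Γ(X, V')) (x : Γ(sheafHom V M, V')) {W : X.Opens} (hWV : W ≤ V')
    (hrW : X.basicOpen r ≤ W)
    (hx : (sheafHom V M).presheaf.map (homOfLE hWV).op x = 0) : ∃ n : ℕ, r ^ n • x = 0 := by
  classical
  let kW : W ⟶ V' := homOfLE hWV
  let eV : SheafOfModules.free I ≅ V.over V' :=
    SheafOfModules.restrictTrivialisation (R := X.ringCatSheaf) (homOfLE hV'U) e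
  let φ : V.over V' ⟶ M.over V' := x
  have hx' : restrictHom kW φ = 0 := hx
  -- the values on the basis sections vanish on `W`
  have hd : ∀ i, M.presheaf.map kW.op (appLE φ (𝟙 V') (basisSection eV i)) = 0 := by
    intro i
    rw [← appLE_map, ← appLE_congr_hom φ (𝟙 W ≫ kW) (kW ≫ 𝟙 V'), ← appLE_restrictHom, hx']
    rfl
  choose n hn using fun i => hM.torsion hV' r (appLE φ (𝟙 V') (basisSection eV i)) hWV hrW (hd i)
  obtain ⟨N, hN⟩ : ∃ N : ℕ, ∀ i, n i ≤ N := ⟨Finset.univ.sup n, fun i => Finset.le_sup (Finset.mem_univ i)⟩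
  refine ⟨N, ?_⟩
  change r ^ N • φ = 0
  refine hom_ext_of_basisSection eV fun i => ?_
  rw [appLE_smul, structurePresheaf_map_id, appLE_zero, ← Nat.sub_add_cancel (hN i), pow_add, mul_smul,
    hn i, smul_zero]


/-- **`𝓗om(V, M)` is affine-localizing for `V` finite locally free and `M` affine-localizing**
(locally on a trivialising open it is checked on the basis sections; `isAffineLocalizing_of_local`). -/
theorem isAffineLocalizing_sheafHom {V M : X.Modules} (hV : IsFiniteLocallyFree V)
    (hM : IsAffineLocalizing M) : IsAffineLocalizing (sheafHom V M) := by
  refine isAffineLocalizing_of_local _ fun x => ?_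
  obtain ⟨U, hxU, I, hI, ⟨e⟩⟩ := hV x
  haveI := Fintype.ofFinite I
  exact ⟨U, hxU, fun V' hV' hV'U r W hW s => sheafHom_numerator hM e hV' hV'U r hW s,
    fun V' hV' hV'U r y W hWV hrW hy => sheafHom_torsion hM e hV' hV'U r y hWV hrW hy⟩

end SheafHom

/-! ### Direct images along closed immersions -/

section Pushforward

variable {Y : Scheme.{u}} (i : X ⟶ Y) {F : X.Modules}

/-- `i♯` commutes with restriction (elementwise naturality of `i.app`). -/
theorem app_presheaf_map {V W : Y.Opens} (h : W ≤ V) (r : Γ(Y, V)) :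
    i.app W (Y.presheaf.map (homOfLE h).op r) =
      X.presheaf.map (homOfLE (show i ⁻¹ᵁ W ≤ i ⁻¹ᵁ V from fun _ hx => h hx)).op (i.app V r) := by
  have e := ConcreteCategory.congr_hom (i.naturality (homOfLE h).op) r
  simp only [CommRingCat.comp_apply] at e
  rw [e]
  rfl

/-- **`i_* F` is affine-localizing for a closed immersion `i` and an affine-localizing `F`**
(`i⁻¹V` is affine for `V` affine, `i⁻¹ D(r) = D(i♯ r)`, and `𝒪_Y` acts on `i_* F` through `i♯`). -/
theorem isAffineLocalizing_pushforward [IsClosedImmersion i] (hF : IsAffineLocalizing F) :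
    IsAffineLocalizing ((Scheme.Modules.pushforward i).obj F) := by
  constructor
  · intro V hV r W hW s
    subst hW
    have hW' : i ⁻¹ᵁ Y.basicOpen r = X.basicOpen (i.app V r) := Scheme.preimage_basicOpen i r
    obtain ⟨n, x, hx⟩ := hF.numerator (hV.preimage i) (i.app V r) hW' s
    refine ⟨n, x, ?_⟩
    change F.presheaf.map ((Opens.map i.base).map (homOfLE (X := Y.Opens) (Y.basicOpen_le r))).op x =
      i.app (Y.basicOpen r) (Y.presheaf.map (homOfLE (Y.basicOpen_le r)).op r ^ n) •
        (show Γ(F, i ⁻¹ᵁ Y.basicOpen r) from s)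
    rw [map_pow, app_presheaf_map, map_eq_map F _ (homOfLE (hW'.trans_le (X.basicOpen_le _))).op, hx]
  · intro V hV r x W hWV hrW hx
    have hW' : i ⁻¹ᵁ Y.basicOpen r = X.basicOpen (i.app V r) := Scheme.preimage_basicOpen i r
    have hWV' : i ⁻¹ᵁ W ≤ i ⁻¹ᵁ V := fun _ h => hWV h
    obtain ⟨n, hn⟩ := hF.torsion (hV.preimage i) (i.app V r) x hWV' (hW'.ge.trans fun _ h => hrW h) (by
      rw [map_eq_map F _ ((Opens.map i.base).map (homOfLE hWV)).op]
      exact hx)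
    refine ⟨n, ?_⟩
    change i.app V (r ^ n) • (show Γ(F, i ⁻¹ᵁ V) from x) = 0
    rw [map_pow]
    exact hn

end Pushforward

/-- **Registered sub-goal** (helper stub of `stub_towerPresentation`, universe `0`): `𝓗om(V, M)` is
affine-localizing for `V` finite locally free and `M` affine-localizing (`isAffineLocalizing_sheafHom`). -/
theorem stub_affineLocalizingSheafHom :
    ∀ (X : AlgebraicGeometry.Scheme.{0}) (V M : X.Modules),
      Literature.AlgebraicGeometry.Motives.IsFiniteLocallyFree V →
      Literature.AlgebraicGeometry.Modules.IsAffineLocalizing M →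
        Literature.AlgebraicGeometry.Modules.IsAffineLocalizing
          (Literature.AlgebraicGeometry.Modules.sheafHom V M) :=
  fun _ _ _ hV hM => isAffineLocalizing_sheafHom hV hM

end Summit.HodgeConjecture.HodgeConjecture.Theorems.FormalVectorBundlesAlgebraize

end
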